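import Mathlib
import HarnessLib
import Summits.HubbardSuperconductivity.HubbardSuperconductivity.Theorems.KLProgrammeKLRegimeTwoVolumeSectorScaleSucc
import Summits.HubbardSuperconductivity.HubbardSuperconductivity.Theorems.KLProgrammeKLRegimeTwoVolumeNearEntry
import Summits.HubbardSuperconductivity.HubbardSuperconductivity.Theorems.KLProgrammeKLRegimeTwoVolumeSectorPeriodisation
import Summits.HubbardSuperconductivity.HubbardSuperconductivity.Theorems.KLProgrammeKLRegimeTwoVolumeGridOverlapPeriodisation
import Summits.HubbardSuperconductivity.HubbardSuperconductivity.Theorems.KLProgrammeKLRegimeTwoVolumeGridBlockStep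
import Literature.MathematicalPhysics.QuantumLattice.GrassmannGramBoundedWeights
import Literature.MathematicalPhysics.QuantumLattice.GrassmannGramBoundedSum
import Literature.MathematicalPhysics.QuantumLattice.GrassmannDefectSplit

/-!
# Route `KLProgramme` — crux K3, VL child `KLRegimeVolumeLimitV17F2` (stmt-HubbardSuperconductivity-20440), (vi) blueprint v4 M3-grid:
# THE TRANSITION `0 → 1` OF THE TWO-VOLUME INDUCTION — from the GRID legs of the ultraviolet step to the sector-field legs of the first sectorised family
# (cell gate-hubbard-kl, seat hubbard-kl-k3c4-p1 g11; `--supports` stmt-…-20440)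

The grid twin of `…TwoVolumeSectorScaleSucc.sector_sum_norm_kernel_twoVolume_scaleSucc_le`: the abstract scale successor `twoVolume_scale_succ_le` (p557484)
with the scale-`j` legs `Γ₁ = GridLeg (GridPoint V (2(2M)))` (the objects of `hubbardGrid_sum_norm_kernel_twoVolume_stepZero_le`, p579487) and the
re-sectorisation `T_V = ε • E_V(F′) · S_V^{grid}` (the engine's reading `klEffectiveAction_zero_eq_effAction_map` ∘ `sectorPreimage_eq_map_smul_sectorAnalysis`;
its periodisation `gridOverlap_periodise_leg`, p582110); STEP covariances on the sector-field legs `SpaceTimeIdx V M × SectorLeg N` as there.  Discharged / kept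
as hypotheses exactly as in the sector twin (regions on the grid legs read the site `y.1.1.2`).

* **`gridSector_sum_norm_kernel_twoVolume_scaleSucc_le`**.  Sorry-free; no definition.
References: BGM 2006 §2.1 (2.5), §2.7 (2.70)–(2.71), §3; Salmhofer 1999 §4.2.4, (2.102)–(2.106).
-/

noncomputable section

namespace Summit.HubbardSuperconductivity.HubbardSuperconductivity.Theorems.TwoVolumeDefect

set_option linter.dupNamespace false -- summit = problem name (single-conjunct summit), D-0017

open Finset Literature.MathematicalPhysics.QuantumLattice GrassmannAlgebra Literature.Probability.LatticeModels
  Literature.Probability.LatticeModels.BattleFederbush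
open Summit.HubbardSuperconductivity.HubbardSuperconductivity.Theorems.TwoPointAssembly

/-- **THE TRANSITION `0 → 1` OF THE TWO-VOLUME INDUCTION** (grid legs at scale `0`, sector-field legs at scale `1`; see the module docstring).
[folklore; BGM 2006 §2.1, §2.7, §3; Salmhofer 1999 (2.102)–(2.106)] -/
theorem gridSector_sum_norm_kernel_twoVolume_scaleSucc_le {b L Lf M N : ℕ} [NeZero Lf] [NeZero L] [NeZero M]
    [LinearOrder (SpaceTimeIdx Lf M × SectorLeg N)]
    (hLf : Lf = b * L) {β : ℝ} (hβ : β ≠ 0)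
    -- the block structures of the scale-`j+1` and scale-`j` legs
    (e : (SpaceTimeIdx Lf M × SectorLeg N) ≃ (Fin 2 → Fin b) × (SpaceTimeIdx L M × SectorLeg N))
    (he1 : ∀ X' i, ((e X').1 i : ℕ) = (X'.1.2 i).val / L) (he2 : ∀ X', (e X').2 = ((X'.1.1, fun i => (((X'.1.2 i).val : ℕ) : ZMod L)), X'.2))
    (e₁ : GridLeg (GridPoint Lf (2 * (2 * M))) ≃ (Fin 2 → Fin b) × GridLeg (GridPoint L (2 * (2 * M))))
    (he₁2 : ∀ X', (e₁ X').2 = (((X'.1.1.1, fun i => (((X'.1.1.2 i).val : ℕ) : ZMod L)), X'.1.2), X'.2))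
    -- the sampled fat family and symbol of the STEP covariances
    (𝔣t : Fin N → MatsubaraIdx M → (Fin 2 → ℝ) → ℂ) (Φ : MatsubaraIdx M → Fin 2 → (Fin 2 → ℝ) → ℂ)
    (FtL : Fin N → FreqMomentum L M → ℂ) (FtLf : Fin N → FreqMomentum Lf M → ℂ)
    (hFtL : ∀ ω i q, FtL ω (i, q) = 𝔣t ω i (latticeMomentum L q)) (hFtLf : ∀ ω i q, FtLf ω (i, q) = 𝔣t ω i (latticeMomentum Lf q))
    (pL : FreqMomentum L M × Fin 2 → ℂ) (pLf : FreqMomentum Lf M × Fin 2 → ℂ)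
    (hpL : ∀ i q σ, pL ((i, q), σ) = ((β * (L : ℝ) ^ 2 : ℝ) : ℂ) * Φ i σ (latticeMomentum L q))
    (hpLf : ∀ i q σ, pLf ((i, q), σ) = ((β * (Lf : ℝ) ^ 2 : ℝ) : ℂ) * Φ i σ (latticeMomentum Lf q))
    (CL : Matrix (SpaceTimeIdx L M × SectorLeg N) (SpaceTimeIdx L M × SectorLeg N) ℂ)
    (hCL : CL = (sectorSubMatrix L M β FtL).transpose * normalCovariance L M pL * sectorSubMatrix L M β FtL)
    (CLf : Matrix (SpaceTimeIdx Lf M × SectorLeg N) (SpaceTimeIdx Lf M × SectorLeg N) ℂ)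
    (hCLf : CLf = (sectorSubMatrix Lf M β FtLf).transpose * normalCovariance Lf M pLf * sectorSubMatrix Lf M β FtLf)
    -- the sampled thin output family of the re-sectorisation `T_V = ε • E_V(F′)·S_V^grid`
    (𝔣' : Fin N → MatsubaraIdx M → (Fin 2 → ℝ) → ℂ)
    (F'L : Fin N → FreqMomentum L M → ℂ) (F'Lf : Fin N → FreqMomentum Lf M → ℂ)
    (hF'L : ∀ ω i q, F'L ω (i, q) = 𝔣' ω i (latticeMomentum L q)) (hF'Lf : ∀ ω i q, F'Lf ω (i, q) = 𝔣' ω i (latticeMomentum Lf q))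
    (Tc : Matrix (SpaceTimeIdx L M × SectorLeg N) (GridLeg (GridPoint L (2 * (2 * M)))) ℂ)
    (hTc : Tc = ((imagTimeWeight β M : ℝ) : ℂ) • (sectorAnalysisMatrix L M β F'L * hubbardGridSub L M β (2 * (2 * M))))
    (Tf : Matrix (SpaceTimeIdx Lf M × SectorLeg N) (GridLeg (GridPoint Lf (2 * (2 * M)))) ℂ)
    (hTf : Tf = ((imagTimeWeight β M : ℝ) : ℂ) • (sectorAnalysisMatrix Lf M β F'Lf * hubbardGridSub Lf M β (2 * (2 * M))))
    -- depth of the zone, extra depth of the pin, the pin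
    (R R' : ℕ) (w : SpaceTimeIdx Lf M × SectorLeg N) (hw : ∀ j, R + R' ≤ (w.1.2 j).val % L ∧ (w.1.2 j).val % L + (R + R') < L)
    -- decay numbers of the two STEP covariances
    {T : ℝ} (hT0 : 0 < T)
    (hT : ∀ X', ∑ Y' ∈ univ.filter (fun Y' : SpaceTimeIdx Lf M × SectorLeg N => R < Torus.tnorm (X'.1.2 - Y'.1.2)), ‖CLf X' Y'‖ ≤ T)
    {Te : ℝ} (hTe : ∀ X' Y' : SpaceTimeIdx Lf M × SectorLeg N,
      ∑ Y'' ∈ univ.filter (fun Y'' : SpaceTimeIdx Lf M × SectorLeg N => (e Y'').2 = (e Y').2 ∧ R < Torus.tnorm (X'.1.2 - Y''.1.2)),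
        ‖CLf X' Y''‖ ≤ Te)
    {s s' : ℝ} (hs0 : 0 ≤ s) (hs'0 : 0 ≤ s') (hs : ∀ X Y, ‖CL X Y‖ ≤ s) (hs' : ∀ X' Y', ‖CLf X' Y'‖ ≤ s')
    {α α' : ℝ} (hαα : 0 < α' + α) (hrow : ∀ X, ∑ Y, ‖CL X Y‖ ≤ α) (hrow' : ∀ X', ∑ Y', ‖CLf X' Y'‖ ≤ α')
    {m₁ m₁' : ℝ} (hm0 : 0 ≤ m₁) (hm0' : 0 ≤ m₁')
    (hm1 : ∀ X, ∑ Y, ‖CL X Y‖ * (Torus.tnorm (X.1.2 - Y.1.2) : ℝ) ≤ m₁)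
    (hm1' : ∀ X', ∑ Y', ‖CLf X' Y'‖ *
      (Torus.tnorm ((fun i => (((X'.1.2 i).val : ℕ) : ZMod L)) - fun i => (((Y'.1.2 i).val : ℕ) : ZMod L)) : ℝ) ≤ m₁')
    {κ κ' : ℝ} (hκ : 0 < κ) (hκ' : 0 < κ') (hGB : IsGramBoundedR CL κ) (hGB' : IsGramBoundedR CLf κ')
    -- the two scale-`j` actions (block-periodic one-volume objects), the coarse unit and OUTPUT weighted profile, two smallness conditions
    (𝒲 : GrassmannAlgebra ℂ (GridLeg (GridPoint L (2 * (2 * M))))) (h𝒲e : 𝒲 ∈ evenOdd ℂ 0) (h𝒲0 : constPart ℂ 𝒲 = 0)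
    (𝒲' : GrassmannAlgebra ℂ (GridLeg (GridPoint Lf (2 * (2 * M))))) (h𝒲'e : 𝒲' ∈ evenOdd ℂ 0) (h𝒲'0 : constPart ℂ 𝒲' = 0)
    (hZ : IsUnit (effPartitionFn ℂ CL (ExteriorAlgebra.map (Matrix.toLin' Tc) 𝒲)))
    (Nw : ℕ → ℝ) (hNw0 : ∀ m, 0 ≤ Nw m)
    (hNw : ∀ (m' : ℕ) (j : Fin (2 * m')) (x : SpaceTimeIdx L M × SectorLeg N),
      ∑ Y ∈ univ.filter (fun Y : Fin (2 * m') → SpaceTimeIdx L M × SectorLeg N => Y j = x),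
        ‖kernel ℂ (effAction ℂ CL (ExteriorAlgebra.map (Matrix.toLin' Tc) 𝒲)) (2 * m') Y‖ *
          (1 + labelDiam (fun Y₁ Y₂ : SpaceTimeIdx L M × SectorLeg N => (Torus.tnorm (Y₁.1.2 - Y₂.1.2) : ℝ)) (univ.image Y)) ≤ Nw m')
    {ρf : ℝ} (hρf : 0 < ρf)
    (hθw : Real.exp 1 * (α' + α + (m₁' + m₁)) * normV (SpaceTimeIdx Lf M × SectorLeg N) (κ' + κ) ρf Nw / (κ' + κ) ^ 2 < 1)
    {ρ₂ : ℝ} (hρ₂ : 0 < ρ₂)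
    (hθ₂ : Real.exp 1 * (α' + α + (m₁' + m₁)) * normV (SpaceTimeIdx Lf M × SectorLeg N) (κ' + κ + (κ' + κ + (κ' + κ))) ρ₂ Nw /
      (κ' + κ + (κ' + κ + (κ' + κ))) ^ 2 < 1)
    -- the INTERACTION bracket: weighted rows of the fine covariance (block-periodic residue distance), the two re-sectorised input profiles
    {αw : ℝ} (hαw : 0 < αw)
    (hroww : ∀ X', ∑ Y', ‖CLf X' Y'‖ *
      (1 + (Torus.tnorm ((fun i => (((X'.1.2 i).val : ℕ) : ZMod L)) - fun i => (((Y'.1.2 i).val : ℕ) : ZMod L)) : ℝ)) ≤ αw)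
    (hcolw : ∀ Y', ∑ X', ‖CLf X' Y'‖ *
      (1 + (Torus.tnorm ((fun i => (((X'.1.2 i).val : ℕ) : ZMod L)) - fun i => (((Y'.1.2 i).val : ℕ) : ZMod L)) : ℝ)) ≤ αw)
    (NV NW' : ℕ → ℝ) (hNV0 : ∀ m', 0 ≤ NV m') (hNW'0 : ∀ m', 0 ≤ NW' m')
    (hNV : ∀ m' (j : Fin (2 * m')) (x : SpaceTimeIdx L M × SectorLeg N),
      ∑ Y ∈ univ.filter (fun Y : Fin (2 * m') → SpaceTimeIdx L M × SectorLeg N => Y j = x),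
        ‖kernel ℂ (ExteriorAlgebra.map (Matrix.toLin' Tc) 𝒲) (2 * m') Y‖ *
          (1 + labelDiam (fun Y₁ Y₂ : SpaceTimeIdx L M × SectorLeg N => (Torus.tnorm (Y₁.1.2 - Y₂.1.2) : ℝ)) (univ.image Y)) ≤ NV m')
    (hNW' : ∀ m' (j : Fin (2 * m')) (x : SpaceTimeIdx Lf M × SectorLeg N),
      ∑ Y ∈ univ.filter (fun Y : Fin (2 * m') → SpaceTimeIdx Lf M × SectorLeg N => Y j = x),
        ‖kernel ℂ (ExteriorAlgebra.map (Matrix.toLin' Tf) 𝒲') (2 * m') Y‖ *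
          (1 + labelDiam (fun Y₁ Y₂ : SpaceTimeIdx Lf M × SectorLeg N =>
            (Torus.tnorm ((fun i => (((Y₁.1.2 i).val : ℕ) : ZMod L)) - fun i => (((Y₂.1.2 i).val : ℕ) : ZMod L)) : ℝ)) (univ.image Y)) ≤ NW' m')
    -- the TRANSFER data of `T_{L″}`: radii of the regions, column / window / row bounds `aT`, tails `τT`
    (RN RZ RF : ℕ) (hNZ : RN ≤ RZ) {aT τT : ℝ} (haT : 0 ≤ aT) (hτT : 0 ≤ τT)
    (hcolT : ∀ y', ∑ x, ‖Tf x y'‖ ≤ aT)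
    (hwinT : ∀ (β' : Fin 2 → Fin b) (y : GridLeg (GridPoint L (2 * (2 * M)))),
      ∑ β, ∑ x ∈ univ.filter (fun x : SpaceTimeIdx Lf M × SectorLeg N => (e x).1 = β'), ‖Tf x (e₁.symm (β, y))‖ ≤ aT)
    (hρT : ∀ x : SpaceTimeIdx Lf M × SectorLeg N, (∀ j, R ≤ (x.1.2 j).val % L ∧ (x.1.2 j).val % L + R < L) →
      ∑ y, ‖Tf x (e₁.symm ((e x).1, y))‖ ≤ aT)
    (hrowFT : ∀ x : SpaceTimeIdx Lf M × SectorLeg N, (∀ j, R ≤ (x.1.2 j).val % L ∧ (x.1.2 j).val % L + R < L) →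
      ∑ y' ∈ univ.filter (fun y' : GridLeg (GridPoint Lf (2 * (2 * M))) => Torus.tnorm (x.1.2 - y'.1.1.2) ≤ RF), ‖Tf x y'‖ ≤ aT)
    (hτFT : ∀ x : SpaceTimeIdx Lf M × SectorLeg N, (∀ j, R ≤ (x.1.2 j).val % L ∧ (x.1.2 j).val % L + R < L) →
      ∑ y' ∈ univ.filter (fun y' : GridLeg (GridPoint Lf (2 * (2 * M))) => ¬ Torus.tnorm (x.1.2 - y'.1.1.2) ≤ RF), ‖Tf x y'‖ ≤ τT)
    (hτ₁T : ∀ x : SpaceTimeIdx Lf M × SectorLeg N, (∀ j, R ≤ (x.1.2 j).val % L ∧ (x.1.2 j).val % L + R < L) →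
      ∀ y : GridLeg (GridPoint L (2 * (2 * M))), ¬ RZ < Torus.tnorm ((e x).2.1.2 - y.1.1.2) →
        ∑ x₂ ∈ univ.filter (fun x₂ : SpaceTimeIdx Lf M × SectorLeg N => (e x₂).1 ≠ (e x).1), ‖Tf x₂ (e₁.symm ((e x).1, y))‖ ≤ τT)
    (hτ₂T : ∀ x : SpaceTimeIdx Lf M × SectorLeg N, (∀ j, R ≤ (x.1.2 j).val % L ∧ (x.1.2 j).val % L + R < L) →
      ∑ β ∈ univ.erase (e x).1, ∑ y, ‖Tf x (e₁.symm (β, y))‖ ≤ τT)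
    (hτ₃T : ∀ x : SpaceTimeIdx Lf M × SectorLeg N, (∀ j, R ≤ (x.1.2 j).val % L ∧ (x.1.2 j).val % L + R < L) →
      ∑ y ∈ univ.filter (fun y : GridLeg (GridPoint L (2 * (2 * M))) => ¬ Torus.tnorm ((e x).2.1.2 - y.1.1.2) ≤ RN),
        ‖Tf x (e₁.symm ((e x).1, y))‖ ≤ τT)
    (hτ₄T : ∀ x : SpaceTimeIdx Lf M × SectorLeg N, (∀ j, R ≤ (x.1.2 j).val % L ∧ (x.1.2 j).val % L + R < L) →
      ∀ y : GridLeg (GridPoint L (2 * (2 * M))), ¬ RZ < Torus.tnorm ((e x).2.1.2 - y.1.1.2) →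
        ∑ β ∈ univ.erase (e x).1, ∑ x₂ ∈ univ.filter (fun x₂ : SpaceTimeIdx Lf M × SectorLeg N => (e x₂).1 = (e x).1),
          ‖Tf x₂ (e₁.symm (β, y))‖ ≤ τT)
    -- ONE-volume scale-`j` profiles of the coarse action and the scale-`j` TWO-VOLUME data (block-reduced form), the majorant `Ein`
    (Nj Nfarj Ej NDj : ℕ → ℝ) (hNj0 : ∀ k, 0 ≤ Nj k) (hNfarj0 : ∀ k, 0 ≤ Nfarj k) (hEj0 : ∀ k, 0 ≤ Ej k) (hNDj0 : ∀ k, 0 ≤ NDj k)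
    (hNj : ∀ (k : ℕ) (p : Fin k) (y : GridLeg (GridPoint L (2 * (2 * M)))),
      ∑ Y ∈ univ.filter (fun Y : Fin k → GridLeg (GridPoint L (2 * (2 * M))) => Y p = y), ‖kernel ℂ 𝒲 k Y‖ ≤ Nj k)
    (hNfarj : ∀ (k : ℕ) (p : Fin k) (y : GridLeg (GridPoint L (2 * (2 * M)))) (i : Fin k),
      ∑ Y ∈ univ.filter (fun Y : Fin k → GridLeg (GridPoint L (2 * (2 * M))) => Y p = y ∧ RZ - RN < Torus.tnorm ((Y p).1.1.2 - (Y i).1.1.2)),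
        ‖kernel ℂ 𝒲 k Y‖ ≤ Nfarj k)
    (hEj : ∀ x : SpaceTimeIdx Lf M × SectorLeg N, (∀ j, R ≤ (x.1.2 j).val % L ∧ (x.1.2 j).val % L + R < L) →
      ∀ (k : ℕ) (p : Fin k) (y' : GridLeg (GridPoint Lf (2 * (2 * M)))), Torus.tnorm (x.1.2 - y'.1.1.2) ≤ RF →
        ∑ Y' ∈ univ.filter (fun Y' : Fin k → GridLeg (GridPoint Lf (2 * (2 * M))) => Y' p = y'),
          ‖kernel ℂ 𝒲' k Y' - (if ∀ i, (e₁ (Y' i)).1 = (e₁ (Y' p)).1 then kernel ℂ 𝒲 k (fun i => (e₁ (Y' i)).2) else 0)‖ ≤ Ej k)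
    (hNDj : ∀ (k : ℕ) (p : Fin k) (y' : GridLeg (GridPoint Lf (2 * (2 * M)))),
      ∑ Y' ∈ univ.filter (fun Y' : Fin k → GridLeg (GridPoint Lf (2 * (2 * M))) => Y' p = y'),
        ‖kernel ℂ 𝒲' k Y' - (if ∀ i, (e₁ (Y' i)).1 = (e₁ (Y' p)).1 then kernel ℂ 𝒲 k (fun i => (e₁ (Y' i)).2) else 0)‖ ≤ NDj k)
    (Ein : ℕ → ℝ) (hEin0 : ∀ m', 0 ≤ Ein m')
    (hEin : ∀ m', 1 ≤ m' → ∀ n : ℕ, 2 * m' = n + 1 → aT ^ n * (aT * Ej (n + 1) + τT * NDj (n + 1)) +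
      (2 * aT ^ n * τT * Nj (n + 1) + n * aT ^ n * (5 * τT * Nj (n + 1) + 2 * aT * Nfarj (n + 1))) ≤ Ein m')
    {ρ' : ℝ} (hρ' : 0 < ρ') {νEbar : ℝ} (hνE : normV (SpaceTimeIdx Lf M × SectorLeg N) κ' ρ' Ein ≤ νEbar)
    (hbar : Real.exp 1 * αw * (normV (SpaceTimeIdx Lf M × SectorLeg N) κ' ρ' (fun m' => NV m' + (NW' m' + NV m')) + νEbar) / κ' ^ 2 < 1)
    (hθ₂' : Real.exp 1 * αw * (normV (SpaceTimeIdx Lf M × SectorLeg N) κ' ρ' NV +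
      normV (SpaceTimeIdx Lf M × SectorLeg N) κ' ρ' (fun m' => NW' m' + NV m')) / κ' ^ 2 < 1)
    (n : ℕ) (p : Fin (n + 1)) :
    ∑ X ∈ univ.filter (fun X : Fin (n + 1) → SpaceTimeIdx Lf M × SectorLeg N => X p = w),
        ‖kernel ℂ (effAction ℂ CLf (ExteriorAlgebra.map (Matrix.toLin' Tf) 𝒲')) (n + 1) X -
          (if ∀ i, (e (X i)).1 = (e (X p)).1 then
            kernel ℂ (effAction ℂ CL (ExteriorAlgebra.map (Matrix.toLin' Tc) 𝒲)) (n + 1) (fun i => (e (X i)).2) else 0)‖ ≤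
      (ρ'⁻¹ ^ (n + 1) * Real.exp 1 / (1 - Real.exp 1 * αw * (normV (SpaceTimeIdx Lf M × SectorLeg N) κ' ρ' (fun m' => NV m' + (NW' m' + NV m')) + νEbar) / κ' ^ 2) ^ 2) * normV (SpaceTimeIdx Lf M × SectorLeg N) κ' ρ' Ein +
        (ρ'⁻¹ ^ (n + 1) * (Real.exp 1 * normV (SpaceTimeIdx Lf M × SectorLeg N) κ' ρ' (fun m' => NW' m' + NV m')) / (1 - Real.exp 1 * αw * (normV (SpaceTimeIdx Lf M × SectorLeg N) κ' ρ' NV + normV (SpaceTimeIdx Lf M × SectorLeg N) κ' ρ' (fun m' => NW' m' + NV m')) / κ' ^ 2) ^ 2) * (1 + ((R' : ℝ) + 1))⁻¹ +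
        ((((n + 1 + 1) * (n + 1 + 2) : ℕ) : ℝ) / 2 *
            (ρ₂⁻¹ ^ (n + 3) * (Real.exp 1 * normV (SpaceTimeIdx Lf M × SectorLeg N) (κ' + κ + (κ' + κ + (κ' + κ))) ρ₂ Nw) / (1 - Real.exp 1 * (α' + α + (m₁' + m₁)) * normV (SpaceTimeIdx Lf M × SectorLeg N) (κ' + κ + (κ' + κ + (κ' + κ))) ρ₂ Nw / (κ' + κ + (κ' + κ + (κ' + κ))) ^ 2))) * Te +
        (‖(2 : ℂ)⁻¹‖ * ∑ a ∈ range (n + 2), ∑ b ∈ range (n + 2),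
            (if a + b = n + 1 then (((a + 1) * (b + 1) : ℕ) : ℝ) *
              (4 * (ρ₂⁻¹ ^ (a + 1) * (Real.exp 1 * normV (SpaceTimeIdx Lf M × SectorLeg N) (κ' + κ + (κ' + κ + (κ' + κ))) ρ₂ Nw) / (1 - Real.exp 1 * (α' + α + (m₁' + m₁)) * normV (SpaceTimeIdx Lf M × SectorLeg N) (κ' + κ + (κ' + κ + (κ' + κ))) ρ₂ Nw / (κ' + κ + (κ' + κ + (κ' + κ))) ^ 2)) *
                (ρ₂⁻¹ ^ (b + 1) * (Real.exp 1 * normV (SpaceTimeIdx Lf M × SectorLeg N) (κ' + κ + (κ' + κ + (κ' + κ))) ρ₂ Nw) / (1 - Real.exp 1 * (α' + α + (m₁' + m₁)) * normV (SpaceTimeIdx Lf M × SectorLeg N) (κ' + κ + (κ' + κ + (κ' + κ))) ρ₂ Nw / (κ' + κ + (κ' + κ + (κ' + κ))) ^ 2))) else 0)) * T +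
        ((((n + 1 + 1) * (n + 1 + 2) : ℕ) : ℝ) / 2 * (s' + s) *
              (ρf⁻¹ ^ (n + 3) * (Real.exp 1 * normV (SpaceTimeIdx Lf M × SectorLeg N) (κ' + κ) ρf Nw) / (1 - Real.exp 1 * (α' + α + (m₁' + m₁)) * normV (SpaceTimeIdx Lf M × SectorLeg N) (κ' + κ) ρf Nw / (κ' + κ) ^ 2)) +
            ‖(2 : ℂ)⁻¹‖ * ∑ a ∈ range (n + 2), ∑ b ∈ range (n + 2),
              (if a + b = n + 1 then (((a + 1) * (b + 1) : ℕ) : ℝ) *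
                (2 * (α' + α) * (ρf⁻¹ ^ (a + 1) * (Real.exp 1 * normV (SpaceTimeIdx Lf M × SectorLeg N) (κ' + κ) ρf Nw) / (1 - Real.exp 1 * (α' + α + (m₁' + m₁)) * normV (SpaceTimeIdx Lf M × SectorLeg N) (κ' + κ) ρf Nw / (κ' + κ) ^ 2)) *
                  (ρf⁻¹ ^ (b + 1) * (Real.exp 1 * normV (SpaceTimeIdx Lf M × SectorLeg N) (κ' + κ) ρf Nw) / (1 - Real.exp 1 * (α' + α + (m₁' + m₁)) * normV (SpaceTimeIdx Lf M × SectorLeg N) (κ' + κ) ρf Nw / (κ' + κ) ^ 2))) else 0)) * ((R' : ℝ) + 1)⁻¹ := by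
  classical
  -- block embeddings per box, at both scales
  set Fe : (Fin 2 → Fin b) → ((SpaceTimeIdx L M × SectorLeg N) → ℂ) →ₗ[ℂ] ((SpaceTimeIdx Lf M × SectorLeg N) → ℂ) := fun β' =>
    LinearMap.pi (fun X' : SpaceTimeIdx Lf M × SectorLeg N => if (e X').1 = β' then
      (LinearMap.proj (e X').2 : ((SpaceTimeIdx L M × SectorLeg N) → ℂ) →ₗ[ℂ] ℂ) else 0) with hFe_def
  have hFe : ∀ β' v X', Fe β' v X' = if (e X').1 = β' then v (e X').2 else 0 := fun β' v X' => blockEmb_pi_apply ℂ e β' v X'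
  set Fe₁ : (Fin 2 → Fin b) → ((GridLeg (GridPoint L (2 * (2 * M)))) → ℂ) →ₗ[ℂ] ((GridLeg (GridPoint Lf (2 * (2 * M)))) → ℂ) := fun β' =>
    LinearMap.pi (fun X' : GridLeg (GridPoint Lf (2 * (2 * M))) => if (e₁ X').1 = β' then
      (LinearMap.proj (e₁ X').2 : ((GridLeg (GridPoint L (2 * (2 * M)))) → ℂ) →ₗ[ℂ] ℂ) else 0) with hFe₁_def
  have hFe₁ : ∀ β' v X', Fe₁ β' v X' = if (e₁ X').1 = β' then v (e₁ X').2 else 0 := fun β' v X' => blockEmb_pi_apply ℂ e₁ β' v X'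
  -- the pieces
  set Ccop : Matrix (SpaceTimeIdx Lf M × SectorLeg N) (SpaceTimeIdx Lf M × SectorLeg N) ℂ :=
    Matrix.of fun X' Y' => if (e X').1 = (e Y').1 then CL (e X').2 (e Y').2 else 0 with hCcop_def
  set Zs : Set (SpaceTimeIdx Lf M × SectorLeg N) := {X' | ¬ ∀ j, R ≤ (X'.1.2 j).val % L ∧ (X'.1.2 j).val % L + R < L} with hZs_def
  set Df : Matrix (SpaceTimeIdx Lf M × SectorLeg N) (SpaceTimeIdx Lf M × SectorLeg N) ℂ :=
    Matrix.of fun X' Y' => if X' ∈ Zs ∧ Y' ∈ Zs then CLf X' Y' - Ccop X' Y' else 0 with hDf_def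
  set Dn : Matrix (SpaceTimeIdx Lf M × SectorLeg N) (SpaceTimeIdx Lf M × SectorLeg N) ℂ :=
    Matrix.of fun X' Y' => if X' ∈ Zs ∧ Y' ∈ Zs then 0 else CLf X' Y' - Ccop X' Y' with hDn_def
  have hCcop : ∀ X' Y', Ccop X' Y' = if (e X').1 = (e Y').1 then CL (e X').2 (e Y').2 else 0 := fun X' Y' => rfl
  have hDf : ∀ X' Y', Df X' Y' = if X' ∈ Zs ∧ Y' ∈ Zs then CLf X' Y' - Ccop X' Y' else 0 := fun X' Y' => rfl
  have hDn : ∀ X' Y', Dn X' Y' = if X' ∈ Zs ∧ Y' ∈ Zs then 0 else CLf X' Y' - Ccop X' Y' := fun X' Y' => rfl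
  -- (P) periodisation of the pull-backs and of the re-sectorisations; antisymmetry
  have hP : ∀ (X' : SpaceTimeIdx Lf M × SectorLeg N) (Y : SpaceTimeIdx L M × SectorLeg N),
      ∑ Y'' ∈ univ.filter (fun Y'' : SpaceTimeIdx Lf M × SectorLeg N => (e Y'').2 = Y), CLf X' Y'' = CL (e X').2 Y := by
    intro X' Y
    rw [hCL, hCLf]
    exact sectorPullback_periodise_leg hLf hβ 𝔣t Φ FtL FtLf hFtL hFtLf pL pLf hpL hpLf e he2 X' Y
  have hPT : ∀ (X' : SpaceTimeIdx Lf M × SectorLeg N) (Y : GridLeg (GridPoint L (2 * (2 * M)))),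
      ∑ Y'' ∈ univ.filter (fun Y'' : GridLeg (GridPoint Lf (2 * (2 * M))) => (e₁ Y'').2 = Y), Tf X' Y'' = Tc (e X').2 Y := by
    intro X' Y
    rw [hTc, hTf]
    simp only [Matrix.smul_apply, smul_eq_mul, ← mul_sum]
    rw [gridOverlap_periodise_leg hLf hβ 𝔣' F'L F'Lf hF'L hF'Lf e₁ he₁2 X' Y, he2]
  have hCt : ∀ X Y, CL Y X = -CL X Y := fun X Y => by rw [hCL]; exact sectorPullback_swap β FtL pL X Y
  have hC't : ∀ X' Y', CLf Y' X' = -CLf X' Y' := fun X' Y' => by rw [hCLf]; exact sectorPullback_swap β FtLf pLf X' Y'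
  -- geometry: (G1), (G2); distances; the pin is far from the zone, non-deep legs are far from the pin; the transfer triangle
  have hG1 : ∀ X' Y', (e X').1 ≠ (e Y').1 → ¬ (X' ∈ Zs ∧ Y' ∈ Zs) → R < Torus.tnorm (X'.1.2 - Y'.1.2) :=
    fun X' Y' hne hnz => sector_far_of_block_ne hLf e he1 hne hnz
  have hG2 : ∀ X' Y' Y'', (e X').1 = (e Y').1 → (e Y'').2 = (e Y').2 → Y'' ≠ Y' → ¬ (X' ∈ Zs ∧ Y' ∈ Zs) →
      R < Torus.tnorm (X'.1.2 - Y''.1.2) :=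
    fun X' Y' Y'' hb hf hn hnz => sector_far_of_fibre_ne hLf e he1 he2 hb hf hn hnz
  set dc : (SpaceTimeIdx L M × SectorLeg N) → (SpaceTimeIdx L M × SectorLeg N) → ℝ :=
    fun Y₁ Y₂ => (Torus.tnorm (Y₁.1.2 - Y₂.1.2) : ℝ) with hdc_def
  have hdc : IsLabelDist dc := isLabelDist_tnorm_sectorSite
  set d' : (SpaceTimeIdx Lf M × SectorLeg N) → (SpaceTimeIdx Lf M × SectorLeg N) → ℝ := fun X' Y' => dc (e X').2 (e Y').2 with hd'_def
  have hd' : IsLabelDist d' := hdc.comap (fun X' => (e X').2)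
  have hd'red : ∀ X' Y' : SpaceTimeIdx Lf M × SectorLeg N, d' X' Y' =
      (Torus.tnorm ((fun i => (((X'.1.2 i).val : ℕ) : ZMod L)) - fun i => (((Y'.1.2 i).val : ℕ) : ZMod L)) : ℝ) := by
    intro X' Y'; simp only [hd'_def, hdc_def]; rw [he2, he2]
  have hd'blk : ∀ (β' : Fin 2 → Fin b) (x y : SpaceTimeIdx L M × SectorLeg N), d' (e.symm (β', x)) (e.symm (β', y)) = dc x y := by
    intro β' x y; simp only [hd'_def, Equiv.apply_symm_apply]
  have hdR : ∀ X, X ∈ Zs → (R' : ℝ) + 1 ≤ dc (e X).2 (e w).2 := by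
    intro X hX
    have h := tnorm_red_sub_gt_of_not_deep_of_deep (L := L) hX hw
    simp only [hdc_def]
    rw [he2, he2]
    exact_mod_cast Nat.succ_le_of_lt h
  have hwd : ∀ z : SpaceTimeIdx Lf M × SectorLeg N, ¬ (∀ j, R ≤ (z.1.2 j).val % L ∧ (z.1.2 j).val % L + R < L) →
      (R' : ℝ) + 1 ≤ d' z w := by
    intro z hz
    have h := tnorm_red_sub_gt_of_not_deep_of_deep (L := L) hz hw
    rw [hd'red]
    exact_mod_cast Nat.succ_le_of_lt h
  have hZT : ∀ x : SpaceTimeIdx Lf M × SectorLeg N, (∀ j, R ≤ (x.1.2 j).val % L ∧ (x.1.2 j).val % L + R < L) →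
      ∀ y y' : GridLeg (GridPoint L (2 * (2 * M))), Torus.tnorm ((e x).2.1.2 - y.1.1.2) ≤ RN → RZ < Torus.tnorm ((e x).2.1.2 - y'.1.1.2) →
        RZ - RN < Torus.tnorm (y.1.1.2 - y'.1.1.2) := by
    intro x _ y y' hy hy'
    have htri := Torus.tnorm_add_le ((e x).2.1.2 - y.1.1.2) (y.1.1.2 - y'.1.1.2)
    rw [sub_add_sub_cancel] at htri
    omega
  -- the fine first moment in the pulled-back coarse distance; the weight `φ(s) = 1 + s` and the weighted rows
  have hm1'' : ∀ X', ∑ Y', ‖CLf X' Y'‖ * dc (e X').2 (e Y').2 ≤ m₁' := by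
    intro X'
    refine le_trans (le_of_eq (sum_congr rfl fun Y' _ => ?_)) (hm1' X')
    simp only [hdc_def]
    rw [he2, he2]
  set phi : ℝ → ℝ := fun t => 1 + t with hphi
  have hphi1 : ∀ t, 0 ≤ t → 1 ≤ phi t := fun t ht => by simp only [hphi]; linarith
  have hphimono : ∀ s t, 0 ≤ s → s ≤ t → phi s ≤ phi t := fun s t _ hst => by simp only [hphi]; linarith
  have hphisub : ∀ s t, 0 ≤ s → 0 ≤ t → phi (s + t) ≤ phi s * phi t := fun s t hs ht => by simp only [hphi]; nlinarith
  have hpairw : ∀ X' Y' : SpaceTimeIdx Lf M × SectorLeg N, diamWeight phi d' {X', Y'} =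
      1 + (Torus.tnorm ((fun i => (((X'.1.2 i).val : ℕ) : ZMod L)) - fun i => (((Y'.1.2 i).val : ℕ) : ZMod L)) : ℝ) := by
    intro X' Y'; rw [diamWeight_pair hd', ← hd'red]
  have hroww' : ∀ X', ∑ Y', ‖CLf X' Y'‖ * diamWeight phi d' {X', Y'} ≤ αw := fun X' => by simp only [hpairw]; exact hroww X'
  have hcolw' : ∀ Y', ∑ X', ‖CLf X' Y'‖ * diamWeight phi d' {X', Y'} ≤ αw := fun Y' => by simp only [hpairw]; exact hcolw Y'
  have hwtc : ∀ {k : ℕ} (Y : Fin k → SpaceTimeIdx L M × SectorLeg N), diamWeight phi dc (univ.image Y) = 1 + labelDiam dc (univ.image Y) :=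
    fun Y => rfl
  have hwtf : ∀ {k : ℕ} (Y : Fin k → SpaceTimeIdx Lf M × SectorLeg N), diamWeight phi d' (univ.image Y) = 1 + labelDiam d' (univ.image Y) :=
    fun Y => rfl
  have hNVp : ∀ m' (j : Fin (2 * m')) (x : SpaceTimeIdx L M × SectorLeg N),
      ∑ Y ∈ univ.filter (fun Y : Fin (2 * m') → SpaceTimeIdx L M × SectorLeg N => Y j = x),
        ‖kernel ℂ (ExteriorAlgebra.map (Matrix.toLin' Tc) 𝒲) (2 * m') Y‖ * diamWeight phi dc (univ.image Y) ≤ NV m' := by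
    intro m' j x; simp only [hwtc]; exact hNV m' j x
  have hlabf : ∀ {k : ℕ} (Y : Fin k → SpaceTimeIdx Lf M × SectorLeg N), labelDiam d' (univ.image Y) =
      labelDiam (fun Y₁ Y₂ : SpaceTimeIdx Lf M × SectorLeg N =>
        (Torus.tnorm ((fun i => (((Y₁.1.2 i).val : ℕ) : ZMod L)) - fun i => (((Y₂.1.2 i).val : ℕ) : ZMod L)) : ℝ)) (univ.image Y) := by
    intro k Y
    have hfun : d' = fun Y₁ Y₂ : SpaceTimeIdx Lf M × SectorLeg N =>
        (Torus.tnorm ((fun i => (((Y₁.1.2 i).val : ℕ) : ZMod L)) - fun i => (((Y₂.1.2 i).val : ℕ) : ZMod L)) : ℝ) :=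
      funext fun Y₁ => funext fun Y₂ => hd'red Y₁ Y₂
    rw [hfun]
  have hNW'p : ∀ m' (j : Fin (2 * m')) (x : SpaceTimeIdx Lf M × SectorLeg N),
      ∑ Y ∈ univ.filter (fun Y : Fin (2 * m') → SpaceTimeIdx Lf M × SectorLeg N => Y j = x),
        ‖kernel ℂ (ExteriorAlgebra.map (Matrix.toLin' Tf) 𝒲') (2 * m') Y‖ * diamWeight phi d' (univ.image Y) ≤ NW' m' := by
    intro m' j x; simp only [hwtf, hlabf]; exact hNW' m' j x
  -- the Gram PROPERTIES of the two defects from those of `C_L`, `C_{L″}`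
  have hGBcop : IsGramBoundedR Ccop κ := isGramBoundedR_blockCopies hGB (fun X' => (e X').1) (fun X' => (e X').2) Ccop hCcop
  have hGBsub : IsGramBoundedR (CLf - Ccop) (κ' + κ) := hGB'.sub hGBcop hκ'.le
  have hGBf1 : IsGramBoundedR Df (κ' + κ) :=
    isGramBoundedR_mask hGBsub Zs Df (fun X' Y' => by rw [hDf, Matrix.sub_apply])
  have hGBf : ∀ t ∈ Set.Icc (0 : ℝ) 1, IsGramBoundedR (t • Df) (κ' + κ) := fun t ht => isGramBoundedR_real_smul hGBf1 ht.1 ht.2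
  have hDn_eq : Dn = (CLf - Ccop) - Df := by
    ext X' Y'
    rw [hDn, Matrix.sub_apply, Matrix.sub_apply, hDf]
    split_ifs <;> simp
  have hGBn : IsGramBoundedR Dn (κ' + κ + (κ' + κ)) := by
    rw [hDn_eq]; exact hGBsub.sub hGBf1 (add_nonneg hκ'.le hκ.le)
  have hGB2 : ∀ t ∈ Set.Icc (0 : ℝ) 1, IsGramBoundedR (Df + t • Dn) (κ' + κ + (κ' + κ + (κ' + κ))) := fun t ht =>
    hGBf1.add (isGramBoundedR_real_smul hGBn ht.1 ht.2) (add_nonneg hκ'.le hκ.le)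
  -- the near entries from the fibre tails
  have hTe' : ∀ X' Y', ‖Dn X' Y'‖ ≤ Te :=
    norm_near_le_of_fibreTail e CL CLf Ccop Dn Zs hCcop hDn hP (fun X' Y' => R < Torus.tnorm (X'.1.2 - Y'.1.2)) hG1 hG2 hTe
  -- the scale-`j` two-volume data in glued form
  have hsub₁ : ∀ {k : ℕ} (q : Fin k) (Y' : Fin k → GridLeg (GridPoint Lf (2 * (2 * M)))),
      kernel ℂ (∑ β', ExteriorAlgebra.map (Fe₁ β') 𝒲) k Y' =
        if ∀ i, (e₁ (Y' i)).1 = (e₁ (Y' q)).1 then kernel ℂ 𝒲 k (fun i => (e₁ (Y' i)).2) else 0 :=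
    fun q Y' => kernel_copies_sum e₁ Fe₁ hFe₁ _ q Y'
  have hEj' : ∀ x : SpaceTimeIdx Lf M × SectorLeg N, (∀ j, R ≤ (x.1.2 j).val % L ∧ (x.1.2 j).val % L + R < L) →
      ∀ (k : ℕ) (q : Fin k) (y' : GridLeg (GridPoint Lf (2 * (2 * M)))), Torus.tnorm (x.1.2 - y'.1.1.2) ≤ RF →
        ∑ Y' ∈ univ.filter (fun Y' : Fin k → GridLeg (GridPoint Lf (2 * (2 * M))) => Y' q = y'),
          ‖kernel ℂ (𝒲' - ∑ β', ExteriorAlgebra.map (Fe₁ β') 𝒲) k Y'‖ ≤ Ej k := by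
    intro x hx k q y' hy'
    simp only [kernel_sub', hsub₁ q]
    exact hEj x hx k q y' hy'
  have hNDj' : ∀ (k : ℕ) (q : Fin k) (y' : GridLeg (GridPoint Lf (2 * (2 * M)))),
      ∑ Y' ∈ univ.filter (fun Y' : Fin k → GridLeg (GridPoint Lf (2 * (2 * M))) => Y' q = y'),
        ‖kernel ℂ (𝒲' - ∑ β', ExteriorAlgebra.map (Fe₁ β') 𝒲) k Y'‖ ≤ NDj k := by
    intro k q y'
    simp only [kernel_sub', hsub₁ q]
    exact hNDj k q y'
  -- the e-free reading of the glued output kernel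
  have hsub : ∀ X : Fin (n + 1) → SpaceTimeIdx Lf M × SectorLeg N,
      kernel ℂ (∑ β', ExteriorAlgebra.map (Fe β') (effAction ℂ CL (ExteriorAlgebra.map (Matrix.toLin' Tc) 𝒲))) (n + 1) X =
        if ∀ i, (e (X i)).1 = (e (X p)).1 then
          kernel ℂ (effAction ℂ CL (ExteriorAlgebra.map (Matrix.toLin' Tc) 𝒲)) (n + 1) (fun i => (e (X i)).2) else 0 :=
    fun X => kernel_copies_sum e Fe hFe _ p X
  simp_rw [← hsub]
  -- assemble the abstract scale successor
  have hmain := twoVolume_scale_succ_le e₁ Fe₁ hFe₁ e CL CLf Ccop Dn Df Zs hCcop hDf hDn hP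
    (fun X' Y' => R < Torus.tnorm (X'.1.2 - Y'.1.2)) hG1 hG2 hT0 hT hTe' hCt hC't hs0 hs'0 hs hs' hαα hrow hrow'
    dc hdc hm0 hm0' hm1 hm1''
    (add_pos hκ' hκ) hGBf (add_pos (add_pos hκ' hκ) (add_pos (add_pos hκ' hκ) (add_pos hκ' hκ))) hGB2
    (by positivity : (0 : ℝ) < (R' : ℝ) + 1) w hdR Fe hFe Tc 𝒲 h𝒲e h𝒲0 hZ Nw hNw0 hNw hρf hθw hρ₂ hθ₂
    hκ' hGB' d' hd' hphi1 hphimono hphisub Tf 𝒲' h𝒲'e h𝒲'0 dc hd'blk NV NW' hNV0 hNW'0 hNVp ?iNW'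
    (fun x : SpaceTimeIdx Lf M × SectorLeg N => ∀ j, R ≤ (x.1.2 j).val % L ∧ (x.1.2 j).val % L + R < L)
    (fun (x : SpaceTimeIdx Lf M × SectorLeg N) (y : GridLeg (GridPoint L (2 * (2 * M)))) => RZ < Torus.tnorm ((e x).2.1.2 - y.1.1.2))
    (fun (x : SpaceTimeIdx Lf M × SectorLeg N) (y : GridLeg (GridPoint L (2 * (2 * M)))) => Torus.tnorm ((e x).2.1.2 - y.1.1.2) ≤ RN)
    (fun y y' : GridLeg (GridPoint L (2 * (2 * M))) => RZ - RN < Torus.tnorm (y.1.1.2 - y'.1.1.2))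
    (fun (x : SpaceTimeIdx Lf M × SectorLeg N) (y' : GridLeg (GridPoint Lf (2 * (2 * M)))) => Torus.tnorm (x.1.2 - y'.1.1.2) ≤ RF)
    haT hτT hPT hcolT hwinT hZT hρT hrowFT hτFT hτ₁T hτ₂T hτ₃T hτ₄T
    Nj Nfarj Ej NDj hNj0 hNfarj0 hEj0 hNDj0 hNj hNfarj hEj' hNDj' Ein hEin0 hEin
    hαw ?iroww ?icolw hρ' hνE hbar hθ₂' (by positivity : (0 : ℝ) ≤ (R' : ℝ) + 1) hwd n p
  -- (the Γ′-side weighted data are re-read in the step's `LinearOrder`-derived decidability instances)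
  case iNW' => intro m' j x; convert hNW'p m' j x using 6
  case iroww => intro X'; convert hroww' X' using 6
  case icolw => intro Y'; convert hcolw' Y' using 6
  convert hmain using 3

end Summit.HubbardSuperconductivity.HubbardSuperconductivity.Theorems.TwoVolumeDefect

end
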